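import Literature.Geometry.Kaehler.ComplexTorusZuckerLattice
import Mathlib.NumberTheory.Real.Irrational
import HarnessLib

/-!
# Zucker's Proposition for the explicit `J`-torus `T₀ = ℂ²/L₀`: the integral `(1,1)`-bivectors have rank two

S. Zucker, *The Hodge conjecture for cubic fourfolds*, Compositio Math. 34 (1977), Appendix B,
PROPOSITION (p. 207): "For general `M`, the two classes `ξ` and `η` generate `H^{n,n}(T, ℤ)`",
proved there for `n = 1` (pp. 207–208) as follows: "For an integral `2n`-homology class
`e_m = Σ m_I e_I` to be dual to a cohomology class of type `(n, n)`, it must annihilate every form,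
with constant coefficients, of types `(2n, 0) ⊕ … ⊕ (n+1, n-1)`, and in particular, `dz ∧ dw`.
For each collection of integers `{m_I}`, the relation `(e_m, dz ∧ dw) = 0` is a polynomial in the
entries of `A` and `B` […] If `ab⁻¹` is transcendental over `ℚ`, [the relation] clearly is
satisfied by no non-trivial `4`-tuple of integers."

This file proves the Proposition for the EXPLICIT `J`-lattice `L₀ = ℤv₁ ⊕ ℤv₂ ⊕ ℤJv₁ ⊕ ℤJv₂`,
`v₁ = (1, 1)`, `v₂ = (√2, √3)` of `ComplexTorusZuckerLattice.lean`, in Zucker's own homological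
form, with the transcendence hypothesis replaced by the `ℚ`-linear independence of
`1, √2 + √3, √6`:

* `Zucker.int_linearIndependent_one_sqrtAdd_sqrtMul`: `a + c(√2 + √3) + d√2√3 = 0` with
  `a, c, d ∈ ℤ` forces `a = c = d = 0` (via the irrationality of `√6`, `√2`, `√3`).
* `Zucker.dzdw_v₁_v₂`, …: the six periods of `dz ∧ dw` over the basis bivectors `e_j ∧ e_k` of
  `L₀` (Zucker's "`(2n) × (2n)` minors of `M`"): `√3 - √2`, `-2i`, `-i(√2+√3)`, `-i(√2+√3)`,
  `-2i√6`, `√3 - √2`.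
* **The Proposition** (`Zucker.skew_coeffs_of_dzdw_eq_zero`,
  `Zucker.skew_latticePairing_eq_of_dzdw_eq_zero`): an integer matrix `n` whose bivector
  `Σ n_{jk} e_j ∧ e_k` annihilates `dz ∧ dw` has alternation
  `p (v₁ ∧ v₂ - Jv₁ ∧ Jv₂) + q (v₁ ∧ Jv₂ - v₂ ∧ Jv₁)`, `p = n₀₁ - n₁₀`, `q = n₀₃ - n₃₀`; i.e. the
  integral `(1,1)`-bivectors of `L₀` form the rank-two group spanned by the duals of `ξ = Re ω`,
  `η = Im ω`, and for EVERY constant `2`-form `θ` the period over such a bivector is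
  `p(θ(v₁,v₂) - θ(Jv₁,Jv₂)) + q(θ(v₁,Jv₂) - θ(v₂,Jv₁))`.
* **Consequences used by Zucker's Theorem (p. 208)**:
  `Zucker.skew_latticePairing_dzdzbar_eq_zero`, `…dwdwbar_eq_zero` — `dz ∧ dz̄` and `dw ∧ dw̄`,
  hence the flat Kähler form `(i/2)(dz ∧ dz̄ + dw ∧ dw̄)`, have period `0` over every integral
  `(1,1)`-bivector (so a class carried by an analytic curve, over which the Kähler form integrates
  to the positive area, cannot be one of them: "no effective analytic cycle can be homologous to
  zero on a compact Kähler manifold"); `Zucker.skew_latticePairing_comp_J` — `J_* = -1` on the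
  integral `(1,1)`-bivectors (Zucker's mechanism "`J^*β = -β` for all `β ∈ H^{n,n}(T, ℤ)`", on the
  homology side); `Zucker.skew_proportional_of_dzdw_eq_zero` — no non-zero DECOMPOSABLE integral
  `(1,1)`-bivector: two `ℂ`-dependent lattice vectors are proportional, so no complex line meets
  `L₀` in a lattice and `T₀` contains no one-dimensional complex subtorus.

What this is for: together with de Rham's theorem on `ℂ²` these are the inputs of the barrier fact
`Literature.Barriers.HodgeConjecture.Zucker1977_kaehlerTorus_noAnalyticCycles` that do not involve
analytic subvarieties; the remaining step of Zucker's Theorem — an analytic curve `Z ⊂ T₀` carries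
a non-zero integral `(1,1)`-bivector over which the Kähler form is positive (cycle class /
integration current, or periods of `dz`, `dw` on the normalisation of `Z`) — is NOT here.

## References

* S. Zucker, Compositio Math. 34 (1977) 199–209, Appendix B, Lemma and Proposition p. 207,
  Theorem p. 208. [Zucker1977]
-/

noncomputable section

open scoped ComplexConjugate

namespace Literature.Geometry.Kaehler

namespace Zucker

/-! ### Arithmetic input: `1, √2 + √3, √2·√3` are linearly independent over `ℚ` -/

/-- `√2 · √3 = √6`. [folklore] -/
theorem sqrt_two_mul_sqrt_three : Real.sqrt 2 * Real.sqrt 3 = Real.sqrt 6 := by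
  rw [← Real.sqrt_mul (by norm_num : (0 : ℝ) ≤ 2) 3]
  norm_num

/-- `6` is not a perfect square. [folklore] -/
theorem not_isSquare_six : ¬ IsSquare (6 : ℕ) := by
  rintro ⟨r, hr⟩
  have hr3 : r ≤ 3 := by nlinarith
  interval_cases r <;> omega

/-- `√6` is irrational. [folklore] -/
theorem irrational_sqrt_six : Irrational (Real.sqrt 6) := by
  have h := irrational_sqrt_natCast_iff.mpr not_isSquare_six
  simpa using h

/-- `√3` is irrational. [folklore] -/
theorem irrational_sqrt_three : Irrational (Real.sqrt 3) := by
  simpa using Nat.prime_three.irrational_sqrt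

/-- If `√k` is irrational then `c² = k d²` has no integer solution with `d ≠ 0`. [folklore] -/
theorem eq_zero_of_sq_eq_mul_sq {k : ℕ} (hk : Irrational (Real.sqrt k)) {c d : ℤ}
    (h : c ^ 2 = k * d ^ 2) : d = 0 := by
  by_contra hd
  have hd' : |(d : ℝ)| ≠ 0 := abs_ne_zero.mpr (Int.cast_ne_zero.mpr hd)
  have h1 : (Real.sqrt k * |(d : ℝ)|) ^ 2 = |(c : ℝ)| ^ 2 := by
    rw [mul_pow, Real.sq_sqrt (Nat.cast_nonneg k), sq_abs, sq_abs]
    exact_mod_cast h.symm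
  have h2 : Real.sqrt k * |(d : ℝ)| = |(c : ℝ)| :=
    (pow_left_inj₀ (by positivity) (by positivity) two_ne_zero).1 h1
  have h3 : Real.sqrt k = ((|c| / |d| : ℚ) : ℝ) := by
    push_cast
    rw [eq_div_iff hd', h2]
  exact hk.ne_rat _ h3

/-- **`1, √2 + √3, √6` are linearly independent over `ℚ`** (integer form): the arithmetic input
replacing Zucker's transcendence hypothesis "`ab⁻¹` transcendental over `ℚ`" (p. 208) for the
explicit period point `(√2, √3)` used below. [folklore] -/
theorem int_linearIndependent_one_sqrtAdd_sqrtMul {a c d : ℤ}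
    (h : (a : ℝ) + c * (Real.sqrt 2 + Real.sqrt 3) + d * (Real.sqrt 2 * Real.sqrt 3) = 0) :
    a = 0 ∧ c = 0 ∧ d = 0 := by
  have h2 : Real.sqrt 2 ^ 2 = 2 := Real.sq_sqrt (by norm_num)
  have h3 : Real.sqrt 3 ^ 2 = 3 := Real.sq_sqrt (by norm_num)
  have E : (c : ℝ) * (Real.sqrt 2 + Real.sqrt 3) + a + d * (Real.sqrt 2 * Real.sqrt 3) = 0 := by
    linarith
  -- multiply `E` by the conjugate quantity and reduce with `h2`, `h3`
  have key : ((2 : ℝ) * c ^ 2 - 2 * a * d) * (Real.sqrt 2 * Real.sqrt 3) =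
      a ^ 2 + 6 * d ^ 2 - 5 * c ^ 2 := by
    linear_combination ((c : ℝ) * (Real.sqrt 2 + Real.sqrt 3) - a - d * (Real.sqrt 2 * Real.sqrt 3)) * E
      - (c : ℝ) ^ 2 * h2 - (c : ℝ) ^ 2 * h3 + (d : ℝ) ^ 2 * Real.sqrt 3 ^ 2 * h2 + 2 * (d : ℝ) ^ 2 * h3
  -- the coefficient of `√6` must vanish
  have hcoef : 2 * c ^ 2 - 2 * a * d = 0 := by
    by_contra hne
    have hne' : ((2 : ℝ) * c ^ 2 - 2 * a * d) ≠ 0 := by exact_mod_cast hne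
    have : Real.sqrt 2 * Real.sqrt 3 = (((a ^ 2 + 6 * d ^ 2 - 5 * c ^ 2) / (2 * c ^ 2 - 2 * a * d) : ℚ) : ℝ) := by
      push_cast
      rw [eq_div_iff hne', mul_comm, key]
    rw [sqrt_two_mul_sqrt_three] at this
    exact irrational_sqrt_six.ne_rat _ this
  have hcoefR : ((2 : ℝ) * c ^ 2 - 2 * a * d) = 0 := by exact_mod_cast hcoef
  have hrhs : a ^ 2 + 6 * d ^ 2 - 5 * c ^ 2 = 0 := by
    have : (a : ℝ) ^ 2 + 6 * d ^ 2 - 5 * c ^ 2 = 0 := by rw [← key, hcoefR, zero_mul]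
    exact_mod_cast this
  have hc2 : c ^ 2 = a * d := by linarith
  have hfac : (a - 2 * d) * (a - 3 * d) = 0 := by nlinarith
  rcases mul_eq_zero.mp hfac with ha | ha
  · have ha' : a = 2 * d := by linarith
    have hd : d = 0 := eq_zero_of_sq_eq_mul_sq (k := 2) (by simpa using irrational_sqrt_two)
      (c := c) (by rw [hc2, ha']; push_cast; ring)
    subst hd
    have ha0 : a = 0 := by simpa using ha'
    subst ha0
    exact ⟨rfl, by simpa using hc2, rfl⟩
  · have ha' : a = 3 * d := by linarith
    have hd : d = 0 := eq_zero_of_sq_eq_mul_sq (k := 3) (by simpa using irrational_sqrt_three)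
      (c := c) (by rw [hc2, ha']; push_cast; ring)
    subst hd
    have ha0 : a = 0 := by simpa using ha'
    subst ha0
    exact ⟨rfl, by simpa using hc2, rfl⟩

/-! ### Zucker's Proposition for the skew lattice `L₀` -/

/-- The pairing over `L₀`, in the basis `v₁, v₂, Jv₁, Jv₂`. [cite: Zucker1977, Appendix B p. 207] -/
theorem latticePairing_skewPeriod (θ : (Fin 2 → ℂ) [⋀^Fin 2]→L[ℝ] ℂ) (n : Fin 4 → Fin 4 → ℤ) :
    latticePairing skewPeriod.toLinearMap θ n =
      ((n 0 1 : ℂ) - n 1 0) * θ ![v₁, v₂] + ((n 0 2 : ℂ) - n 2 0) * θ ![v₁, J v₁] +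
      ((n 0 3 : ℂ) - n 3 0) * θ ![v₁, J v₂] + ((n 1 2 : ℂ) - n 2 1) * θ ![v₂, J v₁] +
      ((n 1 3 : ℂ) - n 3 1) * θ ![v₂, J v₂] + ((n 2 3 : ℂ) - n 3 2) * θ ![J v₁, J v₂] := by
  rw [latticePairing_fin_four]
  simp only [LinearEquiv.coe_coe, skewPeriod_single_zero, skewPeriod_single_one,
    skewPeriod_single_two, skewPeriod_single_three]

/-! The six periods of `dz ∧ dw` over the basis bivectors of `L₀` (Zucker p. 207: "`(e_I, dz ∧ dw)`
is a `(2n) × (2n)` minor of `M`"): `√3 - √2`, `-2i`, `-i(√2 + √3)`, `-i(√2 + √3)`, `-2i√2√3`,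
`√3 - √2`. -/

/-- `(dz ∧ dw)(v₁, v₂) = √3 - √2`. [cite: Zucker1977, Appendix B Proposition p. 207] -/
theorem dzdw_v₁_v₂ : dzdw ![v₁, v₂] = ((Real.sqrt 3 - Real.sqrt 2 : ℝ) : ℂ) := by
  simp [v₁, v₂]

/-- `(dz ∧ dw)(v₁, Jv₁) = -2i`. [cite: Zucker1977, Appendix B Proposition p. 207] -/
theorem dzdw_v₁_Jv₁ : dzdw ![v₁, J v₁] = -2 * Complex.I := by
  simp [v₁]
  ring

/-- `(dz ∧ dw)(v₁, Jv₂) = -i(√2 + √3)`. [cite: Zucker1977, Appendix B Proposition p. 207] -/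
theorem dzdw_v₁_Jv₂ : dzdw ![v₁, J v₂] = -((Real.sqrt 2 + Real.sqrt 3 : ℝ) : ℂ) * Complex.I := by
  simp [v₁, v₂]
  ring

/-- `(dz ∧ dw)(v₂, Jv₁) = -i(√2 + √3)`. [cite: Zucker1977, Appendix B Proposition p. 207] -/
theorem dzdw_v₂_Jv₁ : dzdw ![v₂, J v₁] = -((Real.sqrt 2 + Real.sqrt 3 : ℝ) : ℂ) * Complex.I := by
  simp [v₁, v₂]
  ring

/-- `(dz ∧ dw)(v₂, Jv₂) = -2i√2√3`. [cite: Zucker1977, Appendix B Proposition p. 207] -/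
theorem dzdw_v₂_Jv₂ :
    dzdw ![v₂, J v₂] = -2 * ((Real.sqrt 2 * Real.sqrt 3 : ℝ) : ℂ) * Complex.I := by
  simp [v₂]
  ring

/-- `(dz ∧ dw)(Jv₁, Jv₂) = √3 - √2`. [cite: Zucker1977, Appendix B Proposition p. 207] -/
theorem dzdw_Jv₁_Jv₂ : dzdw ![J v₁, J v₂] = ((Real.sqrt 3 - Real.sqrt 2 : ℝ) : ℂ) := by
  simp [v₁, v₂]
  ring_nf
  simp [Complex.I_sq]
  ring

/-- **Zucker's Proposition (Appendix B, p. 207) for the explicit `J`-lattice `L₀`.** An integral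
bivector `Σ n_{jk} e_j ∧ e_k ∈ ⋀² L₀ = H₂(T₀; ℤ)` of the torus `T₀ = ℂ²/L₀` which is of type
`(1, 1)` — i.e. annihilates the holomorphic `2`-form `dz ∧ dw` (Zucker: "for an integral
`2n`-homology class … to be dual to a cohomology class of type `(n, n)`, it must annihilate every
form, with constant coefficients, of types `(2n, 0) ⊕ … ⊕ (n+1, n-1)`, and in particular
`dz ∧ dw`") — has alternation supported on `v₁ ∧ v₂ - Jv₁ ∧ Jv₂` and `v₁ ∧ Jv₂ - v₂ ∧ Jv₁`:
its coefficients satisfy `n₀₂ = n₂₀`, `n₁₃ = n₃₁`, `(n₀₁ - n₁₀) + (n₂₃ - n₃₂) = 0`,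
`(n₀₃ - n₃₀) + (n₁₂ - n₂₁) = 0`. Zucker proves this "for general `M`" (there: `ab⁻¹`
transcendental, `n = 1`); here the period point `(√2, √3)` is explicit and the transcendence is
replaced by the `ℚ`-linear independence of `1, √2 + √3, √6`
(`int_linearIndependent_one_sqrtAdd_sqrtMul`). [cite: Zucker1977, Appendix B Proposition pp. 207–208] -/
theorem skew_coeffs_of_dzdw_eq_zero {n : Fin 4 → Fin 4 → ℤ}
    (h : latticePairing skewPeriod.toLinearMap dzdw n = 0) :
    n 0 2 - n 2 0 = 0 ∧ n 1 3 - n 3 1 = 0 ∧ (n 0 1 - n 1 0) + (n 2 3 - n 3 2) = 0 ∧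
      (n 0 3 - n 3 0) + (n 1 2 - n 2 1) = 0 := by
  rw [latticePairing_skewPeriod, dzdw_v₁_v₂, dzdw_v₁_Jv₁, dzdw_v₁_Jv₂, dzdw_v₂_Jv₁, dzdw_v₂_Jv₂,
    dzdw_Jv₁_Jv₂] at h
  -- split into real and imaginary parts
  set r : ℝ := ((n 0 1 - n 1 0 + (n 2 3 - n 3 2) : ℤ) : ℝ) * (Real.sqrt 3 - Real.sqrt 2) with hr
  set s : ℝ := ((-2 * (n 0 2 - n 2 0) : ℤ) : ℝ) +
    ((-((n 0 3 - n 3 0) + (n 1 2 - n 2 1)) : ℤ) : ℝ) * (Real.sqrt 2 + Real.sqrt 3) +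
    ((-2 * (n 1 3 - n 3 1) : ℤ) : ℝ) * (Real.sqrt 2 * Real.sqrt 3) with hs
  have hX : (r : ℂ) + (s : ℂ) * Complex.I = 0 := by
    rw [← h, hr, hs]
    push_cast
    ring
  have hr0 : r = 0 := by simpa using congrArg Complex.re hX
  have hs0 : s = 0 := by simpa using congrArg Complex.im hX
  have h1 : n 0 1 - n 1 0 + (n 2 3 - n 3 2) = 0 := by
    rcases mul_eq_zero.mp (hr ▸ hr0) with h' | h'
    · exact_mod_cast h'
    · exact absurd h' sqrt_three_sub_sqrt_two_ne_zero
  obtain ⟨ha, hc, hd⟩ := int_linearIndependent_one_sqrtAdd_sqrtMul (hs ▸ hs0)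
  refine ⟨by linarith, by linarith, h1, by linarith⟩

/-- **The integral `(1,1)`-bivectors of `L₀` have rank two** (structure form of Zucker's
Proposition): if `Σ n_{jk} e_j ∧ e_k` annihilates `dz ∧ dw`, then for EVERY constant `2`-form
`θ` its period is `p (θ(v₁, v₂) - θ(Jv₁, Jv₂)) + q (θ(v₁, Jv₂) - θ(v₂, Jv₁))` with the integers
`p = n₀₁ - n₁₀`, `q = n₀₃ - n₃₀`: the bivector is `p (v₁ ∧ v₂ - Jv₁ ∧ Jv₂) + q (v₁ ∧ Jv₂ - v₂ ∧ Jv₁)`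
in `H₂(T₀; ℤ)`, the duals of Zucker's `ξ = Re ω`, `η = Im ω` ("the two classes `ξ` and `η`
generate `H^{n,n}(T, ℤ)`"). [cite: Zucker1977, Appendix B Proposition p. 207] -/
theorem skew_latticePairing_eq_of_dzdw_eq_zero {n : Fin 4 → Fin 4 → ℤ}
    (h : latticePairing skewPeriod.toLinearMap dzdw n = 0) (θ : (Fin 2 → ℂ) [⋀^Fin 2]→L[ℝ] ℂ) :
    latticePairing skewPeriod.toLinearMap θ n =
      ((n 0 1 : ℂ) - n 1 0) * (θ ![v₁, v₂] - θ ![J v₁, J v₂]) +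
      ((n 0 3 : ℂ) - n 3 0) * (θ ![v₁, J v₂] - θ ![v₂, J v₁]) := by
  obtain ⟨h02, h13, h0123, h0312⟩ := skew_coeffs_of_dzdw_eq_zero h
  rw [latticePairing_skewPeriod]
  have e02 : ((n 0 2 : ℂ) - n 2 0) = 0 := by exact_mod_cast h02
  have e13 : ((n 1 3 : ℂ) - n 3 1) = 0 := by exact_mod_cast h13
  have e23 : ((n 2 3 : ℂ) - n 3 2) = -((n 0 1 : ℂ) - n 1 0) := by
    have : n 2 3 - n 3 2 = -(n 0 1 - n 1 0) := by linarith
    exact_mod_cast this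
  have e12 : ((n 1 2 : ℂ) - n 2 1) = -((n 0 3 : ℂ) - n 3 0) := by
    have : n 1 2 - n 2 1 = -(n 0 3 - n 3 0) := by linarith
    exact_mod_cast this
  rw [e02, e13, e23, e12]
  ring

/-! ### Consequences: vanishing areas, `J_* = -1`, no subtori -/

/-- **`dz ∧ dz̄` annihilates every integral `(1,1)`-bivector of `L₀`.** With `dwdwbar` below: the
flat Kähler form `(i/2)(dz ∧ dz̄ + dw ∧ dw̄)` of `T₀ = ℂ²/L₀` has period `0` over every integral
`2`-homology class of type `(1,1)` — whereas its integral over an analytic curve is the (positive)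
area: the positivity half of Zucker's Theorem p. 208 ("no effective analytic cycle can be
homologous to zero on a compact Kähler manifold") then leaves no room for curves on `T₀`.
[cite: Zucker1977, Appendix B Proposition p. 207 and Theorem p. 208] -/
theorem skew_latticePairing_dzdzbar_eq_zero {n : Fin 4 → Fin 4 → ℤ}
    (h : latticePairing skewPeriod.toLinearMap dzdw n = 0) :
    latticePairing skewPeriod.toLinearMap dzdzbar n = 0 := by
  rw [skew_latticePairing_eq_of_dzdw_eq_zero h]
  simp [v₁, v₂]
  ring

/-- **`dw ∧ dw̄` annihilates every integral `(1,1)`-bivector of `L₀`** (see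
`skew_latticePairing_dzdzbar_eq_zero`). [cite: Zucker1977, Appendix B Proposition p. 207 and Theorem p. 208] -/
theorem skew_latticePairing_dwdwbar_eq_zero {n : Fin 4 → Fin 4 → ℤ}
    (h : latticePairing skewPeriod.toLinearMap dzdw n = 0) :
    latticePairing skewPeriod.toLinearMap dwdwbar n = 0 := by
  rw [skew_latticePairing_eq_of_dzdw_eq_zero h]
  simp [v₁, v₂]
  ring

/-- **`J_* = -1` on the integral `(1,1)`-bivectors of `L₀`** (Zucker's mechanism p. 208 on the
homology side: "`J^*ω = i^{2n}ω = -ω` … so `J^*β = -β` for all `β ∈ H^{n,n}(T, ℤ)`"): for every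
constant `2`-form `θ`, the period of `J^*θ = θ ∘ J` over an integral `(1,1)`-bivector is minus that
of `θ`. [cite: Zucker1977, Appendix B Theorem p. 208] -/
theorem skew_latticePairing_comp_J {n : Fin 4 → Fin 4 → ℤ}
    (h : latticePairing skewPeriod.toLinearMap dzdw n = 0) (θ : (Fin 2 → ℂ) [⋀^Fin 2]→L[ℝ] ℂ) :
    latticePairing skewPeriod.toLinearMap (θ.compContinuousLinearMap (J.restrictScalars ℝ)) n =
      -latticePairing skewPeriod.toLinearMap θ n := by
  rw [skew_latticePairing_eq_of_dzdw_eq_zero h, skew_latticePairing_eq_of_dzdw_eq_zero h]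
  have ev : ∀ u u' : Fin 2 → ℂ,
      θ.compContinuousLinearMap (J.restrictScalars ℝ) ![u, u'] = θ ![J u, J u'] := fun u u' ↦ by
    change θ (fun i ↦ J (![u, u'] i)) = θ ![J u, J u']
    congr 1
    funext i; fin_cases i <;> rfl
  simp only [ev, J_J]
  rw [alt_neg₀ θ v₁ (-v₂), alt_neg₁ θ v₁ v₂, alt_neg₁ θ (J v₁) v₂, alt_neg₁ θ (J v₂) v₁,
    alt_swap θ (J v₁) v₂, alt_swap θ (J v₂) v₁]
  ring

/-- The Pfaffian of a decomposable bivector `m ∧ m'` vanishes (Plücker relation). [folklore] -/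
theorem pfaffian_decomposable (m m' : Fin 4 → ℤ) :
    (m 0 * m' 1 - m 1 * m' 0) * (m 2 * m' 3 - m 3 * m' 2) -
      (m 0 * m' 2 - m 2 * m' 0) * (m 1 * m' 3 - m 3 * m' 1) +
      (m 0 * m' 3 - m 3 * m' 0) * (m 1 * m' 2 - m 2 * m' 1) = 0 := by
  ring

/-- **No decomposable integral `(1,1)`-bivector; `T₀` has no subtori of dimension `1`.** If two
lattice vectors `Φ(m), Φ(m') ∈ L₀` are `ℂ`-linearly dependent (`(dz ∧ dw)(Φm, Φm') = 0`, i.e. they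
lie on a common complex line through `0`), then they are proportional: `m ∧ m' = 0`. Hence no
complex line of `ℂ²` meets `L₀` in a lattice, and `T₀ = ℂ²/L₀` contains no translate of a
one-dimensional complex subtorus (the curves with constant Gauss map). By `skew_coeffs_of_dzdw_eq_zero` the
bivector `m ∧ m'` is `p A + q B` with `A ∧ A = B ∧ B ≠ 0 = A ∧ B`, while `(m ∧ m')^{∧2} = 0`
(`pfaffian_decomposable`), forcing `p = q = 0`. [cite: Zucker1977, Appendix B Theorem p. 208] -/
theorem skew_proportional_of_dzdw_eq_zero (m m' : Fin 4 → ℤ)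
    (h : dzdw ![skewPeriod (fun j ↦ (m j : ℝ)), skewPeriod (fun k ↦ (m' k : ℝ))] = 0) :
    ∀ j k, m j * m' k = m k * m' j := by
  have h' : latticePairing skewPeriod.toLinearMap dzdw (fun j k ↦ m j * m' k) = 0 := by
    rw [← apply_intCast_eq_latticePairing]
    exact h
  obtain ⟨h02, h13, h0123, h0312⟩ := skew_coeffs_of_dzdw_eq_zero h'
  have hpf := pfaffian_decomposable m m'
  have e23 : m 2 * m' 3 - m 3 * m' 2 = -(m 0 * m' 1 - m 1 * m' 0) := by linarith
  have e12 : m 1 * m' 2 - m 2 * m' 1 = -(m 0 * m' 3 - m 3 * m' 0) := by linarith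
  rw [e23, e12, h02] at hpf
  have h01 : m 0 * m' 1 - m 1 * m' 0 = 0 := by
    nlinarith [sq_nonneg (m 0 * m' 1 - m 1 * m' 0), sq_nonneg (m 0 * m' 3 - m 3 * m' 0)]
  have h03 : m 0 * m' 3 - m 3 * m' 0 = 0 := by
    nlinarith [sq_nonneg (m 0 * m' 1 - m 1 * m' 0), sq_nonneg (m 0 * m' 3 - m 3 * m' 0)]
  have h23 : m 2 * m' 3 - m 3 * m' 2 = 0 := by linarith
  have h12 : m 1 * m' 2 - m 2 * m' 1 = 0 := by linarith
  intro j k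
  fin_cases j <;> fin_cases k <;> simp <;> linarith

end Zucker

end Literature.Geometry.Kaehler

end
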